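import Mathlib
import HarnessLib
import Literature.MathematicalPhysics.QuantumLattice.LatticeScalarField
import Literature.Probability.LatticeModels.ThermodynamicLimit

/-!
# Route `UniversalDetector`, crux `NonContactScheme` (stmt-QuantumFields-26594): the FREE-KERNEL rung (BC5)

Helper file (`--supports stmt-QuantumFields-26594`) of the ideator seat `ym-idea-8` (generation 2, LINE 4).  The deciding
crux `NonContactScheme` asks for a unit `a(β) → 0` at which the `a⁻⁸`-normalised plaquette pair kernel of 4-D lattice
Yang–Mills is TIGHT (bounded and equicontinuous off the origin, uniformly in `β, L`) and NONCONTACT (no subsequential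
local-uniform limit along `β_k → ∞`, `a L_k → ∞` is identically zero).  This file proves that the two clauses, copied
VERBATIM from the route file with the kernel replaced by the canonical free-field shape `‖a z‖⁻⁸` (the fixed-coupling
massless Gaussian / tree-level shape of `⟨tr F²(0) tr F²(z)⟩`), hold at EVERY unit `a → 0⁺` — the scaling sanity rung of
the crux (statement = `Stmt_rung_freeKernel` of the birth certificate `bc/UniversalDetector_rung_plan.lean`):

* `inv_pow_eight_sub_le` — `u ↦ u⁻⁸` is `8η⁻⁹`-Lipschitz on `[η, ∞)` (mean value theorem);
* `FreeKernel` — TIGHT with `C = η⁻⁸`, `ω(s) = 8η⁻⁹ s`; NONCONTACT by evaluating at the lattice point `z = ⌈a⁻¹⌉ e₀`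
  (physical norm in `[1, 2]`, inside the box once `a L ≥ 2`), where the kernel is `≥ 2⁻⁸` and the limit `K` is within `2⁻⁹`.

A kernel family scaling with any other power of `a` fails one of the two clauses; `U(1)` at `β → ∞` (kernel `O(β⁻²)‖a z‖⁻⁸`)
fails NONCONTACT — as it fails NT(i).  No summit, leg or spine crux is proved here; `NT`, `UV`, `IR` stay open.
-/

set_option autoImplicit false

namespace Summit.QuantumFields.YangMills.Cruxes.NonContactScheme.Rung

open Filter Topology
open Literature.MathematicalPhysics.QuantumLattice Literature.Probability.LatticeModels

/-- `u ↦ (u⁸)⁻¹` is `8η⁻⁹`-Lipschitz on `[η, ∞)`, `η > 0`. -/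
theorem inv_pow_eight_sub_le {η u v : ℝ} (hη : 0 < η) (hu : η ≤ u) (hv : η ≤ v) :
    |(u ^ 8)⁻¹ - (v ^ 8)⁻¹| ≤ 8 * (η ^ 9)⁻¹ * |u - v| := by
  have hs : Convex ℝ (Set.Ici η) := convex_Ici η
  have hd : ∀ x ∈ Set.Ici η, HasDerivAt (fun y : ℝ => (y ^ 8)⁻¹)
      (-(((8 : ℕ) : ℝ) * x ^ (8 - 1)) / (x ^ 8) ^ 2) x := by
    intro x hx
    have hx0 : x ≠ 0 := (lt_of_lt_of_le hη hx).ne'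
    exact (hasDerivAt_pow 8 x).inv (pow_ne_zero 8 hx0)
  have hdiff : ∀ x ∈ Set.Ici η, DifferentiableAt ℝ (fun y : ℝ => (y ^ 8)⁻¹) x :=
    fun x hx => (hd x hx).differentiableAt
  have hbound : ∀ x ∈ Set.Ici η, ‖deriv (fun y : ℝ => (y ^ 8)⁻¹) x‖ ≤ 8 * (η ^ 9)⁻¹ := by
    intro x hx
    have hxpos : 0 < x := lt_of_lt_of_le hη hx
    have hx0 : x ≠ 0 := hxpos.ne'
    have h1 : deriv (fun y : ℝ => (y ^ 8)⁻¹) x = -(8 * (x ^ 9)⁻¹) := by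
      rw [(hd x hx).deriv]
      push_cast
      field_simp
      try ring
    rw [h1, norm_neg, Real.norm_of_nonneg (by positivity)]
    have h2 : (x ^ 9)⁻¹ ≤ (η ^ 9)⁻¹ := inv_anti₀ (pow_pos hη 9) (pow_le_pow_left₀ hη.le hx 9)
    linarith
  have h := hs.norm_image_sub_le_of_norm_deriv_le hdiff hbound hv hu
  simpa [Real.norm_eq_abs] using h

variable {E : Type} [NormedAddCommGroup E]

/-- Bound of the canonical kernel away from the origin. -/
theorem ker_bound {η : ℝ} {x : E} (hη : 0 < η) (hx : η ≤ ‖x‖) : |(‖x‖ ^ 8)⁻¹| ≤ (η ^ 8)⁻¹ := by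
  rw [abs_of_nonneg (inv_nonneg.2 (pow_nonneg (norm_nonneg _) 8))]
  exact inv_anti₀ (pow_pos hη 8) (pow_le_pow_left₀ hη.le hx 8)

/-- Modulus of continuity of the canonical kernel away from the origin. -/
theorem ker_lip {η : ℝ} {x y : E} (hη : 0 < η) (hx : η ≤ ‖x‖) (hy : η ≤ ‖y‖) :
    |(‖x‖ ^ 8)⁻¹ - (‖y‖ ^ 8)⁻¹| ≤ 8 * (η ^ 9)⁻¹ * ‖x - y‖ := by
  have h1 := inv_pow_eight_sub_le hη hx hy
  have h2 : |‖x‖ - ‖y‖| ≤ ‖x - y‖ := abs_norm_sub_norm_le x y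
  have h3 : 0 ≤ 8 * (η ^ 9)⁻¹ := by positivity
  calc |(‖x‖ ^ 8)⁻¹ - (‖y‖ ^ 8)⁻¹| ≤ 8 * (η ^ 9)⁻¹ * |‖x‖ - ‖y‖| := h1
    _ ≤ 8 * (η ^ 9)⁻¹ * ‖x - y‖ := mul_le_mul_of_nonneg_left h2 h3

/-- The norm of the lattice point `m e₀` embedded and scaled by `α > 0` is `α m`. -/
theorem norm_smul_siteToE_axis (α : ℝ) (hα : 0 < α) (m : ℕ) :
    ‖α • siteToE (fun i : Fin 4 => if i = 0 then (m : ℤ) else 0)‖ = α * m := by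
  have hfun : (fun i : Fin 4 => (((if i = 0 then (m : ℤ) else 0 : ℤ)) : ℝ)) = Pi.single (0 : Fin 4) (m : ℝ) := by
    funext i
    by_cases hi : i = 0
    · subst hi; simp
    · simp [hi]
  have hE : siteToE (fun i : Fin 4 => if i = 0 then (m : ℤ) else 0) = EuclideanSpace.single (0 : Fin 4) (m : ℝ) := by
    unfold siteToE
    rw [hfun]
    rfl
  rw [norm_smul, Real.norm_of_nonneg hα.le, hE, PiLp.norm_single, Real.norm_of_nonneg (Nat.cast_nonneg m)]

/-- **The free-kernel rung** (BC5 rung of `NonContactScheme`; statement verbatim from the birth certificate): the canonical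
kernel `‖a z‖⁻⁸` meets TIGHT and NONCONTACT at every unit `a → 0⁺`. -/
theorem FreeKernel :
    ∀ (a : ℝ → ℝ), (∀ β, 0 < a β) → Filter.Tendsto a Filter.atTop (nhds 0) →
    let ker : ℝ → ℕ → (Fin 4 → ℤ) → ℝ := fun β _L z => (‖a β • siteToE z‖ ^ 8)⁻¹;
    (∀ η : ℝ, 0 < η → ∃ (C β₅ Λ₅ : ℝ) (ω : ℝ → ℝ),
        Filter.Tendsto ω (nhdsWithin 0 (Set.Ioi 0)) (nhds 0) ∧
        ∀ β : ℝ, β₅ ≤ β → ∀ L : ℕ, Λ₅ ≤ a β * L → ∀ z ∈ box 4 L, η ≤ ‖a β • siteToE z‖ →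
          |ker β L z| ≤ C ∧ ∀ z' ∈ box 4 L, η ≤ ‖a β • siteToE z'‖ →
            |ker β L z - ker β L z'| ≤ ω ‖a β • siteToE z - a β • siteToE z'‖) ∧
    (∀ (βs : ℕ → ℝ) (Ls : ℕ → ℕ) (K : EuclideanSpace ℝ (Fin 4) → ℝ),
        Filter.Tendsto βs Filter.atTop Filter.atTop →
        Filter.Tendsto (fun k => a (βs k) * Ls k) Filter.atTop Filter.atTop →
        (∀ η ε : ℝ, 0 < η → 0 < ε → ∃ k₀ : ℕ, ∀ k : ℕ, k₀ ≤ k → ∀ z ∈ box 4 (Ls k),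
            η ≤ ‖a (βs k) • siteToE z‖ → ‖a (βs k) • siteToE z‖ ≤ η⁻¹ →
            |ker (βs k) (Ls k) z - K (a (βs k) • siteToE z)| ≤ ε) →
        ∃ z : EuclideanSpace ℝ (Fin 4), z ≠ 0 ∧ K z ≠ 0) := by
  intro a ha hlim ker
  refine ⟨?_, ?_⟩
  · -- TIGHT
    intro η hη
    refine ⟨(η ^ 8)⁻¹, 0, 0, fun s => 8 * (η ^ 9)⁻¹ * s, ?_, ?_⟩
    · have hc : Continuous fun s : ℝ => 8 * (η ^ 9)⁻¹ * s := continuous_const.mul continuous_id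
      have h0 : Filter.Tendsto (fun s : ℝ => 8 * (η ^ 9)⁻¹ * s) (nhds 0) (nhds 0) := by
        simpa using hc.tendsto 0
      exact tendsto_nhdsWithin_of_tendsto_nhds h0
    · intro β _ L _ z _ hz
      refine ⟨?_, ?_⟩
      · exact ker_bound hη hz
      · intro z' _ hz'
        exact ker_lip hη hz hz'
  · -- NONCONTACT
    intro βs Ls K hβ hL hconv
    have ha0 : Filter.Tendsto (fun k => a (βs k)) Filter.atTop (nhds 0) := hlim.comp hβ
    obtain ⟨k₀, hk₀⟩ := hconv (1 / 2) ((2 : ℝ) ^ 9)⁻¹ (by norm_num) (by positivity)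
    obtain ⟨k₁, hk₁⟩ : ∃ k₁ : ℕ, ∀ k : ℕ, k₁ ≤ k → a (βs k) ≤ 1 := by
      have h : ∀ᶠ k in Filter.atTop, a (βs k) ≤ 1 := ha0.eventually (Iic_mem_nhds one_pos)
      exact Filter.eventually_atTop.1 h
    obtain ⟨k₂, hk₂⟩ : ∃ k₂ : ℕ, ∀ k : ℕ, k₂ ≤ k → 2 ≤ a (βs k) * Ls k :=
      Filter.eventually_atTop.1 (Filter.tendsto_atTop.1 hL 2)
    set k : ℕ := max k₀ (max k₁ k₂) with hk
    have hk0 : k₀ ≤ k := le_max_left _ _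
    have hk1 : k₁ ≤ k := le_trans (le_max_left _ _) (le_max_right _ _)
    have hk2 : k₂ ≤ k := le_trans (le_max_right _ _) (le_max_right _ _)
    set α : ℝ := a (βs k) with hαdef
    have hα : 0 < α := ha _
    have hα1 : α ≤ 1 := hk₁ k hk1
    have hαL : 2 ≤ α * Ls k := hk₂ k hk2
    set mN : ℕ := ⌈α⁻¹⌉₊ with hmN
    have hm1 : α⁻¹ ≤ (mN : ℝ) := Nat.le_ceil _
    have hm2 : (mN : ℝ) < α⁻¹ + 1 := Nat.ceil_lt_add_one (inv_nonneg.2 hα.le)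
    have hαm1 : 1 ≤ α * mN := by
      have : α * α⁻¹ = 1 := mul_inv_cancel₀ hα.ne'
      nlinarith [mul_le_mul_of_nonneg_left hm1 hα.le]
    have hαm2 : α * mN ≤ 2 := by
      have h1 : α * (mN : ℝ) < α * (α⁻¹ + 1) := mul_lt_mul_of_pos_left hm2 hα
      rw [mul_add, mul_inv_cancel₀ hα.ne', mul_one] at h1
      linarith
    have hmL : (mN : ℝ) ≤ (Ls k : ℝ) := by
      have h1 : α * (mN : ℝ) ≤ α * (Ls k : ℝ) := le_trans hαm2 hαL
      exact le_of_mul_le_mul_left h1 hα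
    have hmLz : (mN : ℤ) ≤ (Ls k : ℤ) := by exact_mod_cast hmL
    -- the lattice point
    set z : Fin 4 → ℤ := fun i => if i = 0 then (mN : ℤ) else 0 with hz
    have hz_box : z ∈ box 4 (Ls k) := by
      rw [mem_box]
      intro i
      by_cases hi : i = 0
      · simp only [z, hi, if_true]
        constructor <;> omega
      · simp only [z, hi, if_false]
        constructor <;> omega
    have hnorm : ‖α • siteToE z‖ = α * mN := norm_smul_siteToE_axis α hα mN
    have hlow : (1 / 2 : ℝ) ≤ ‖α • siteToE z‖ := by rw [hnorm]; linarith
    have hup : ‖α • siteToE z‖ ≤ (1 / 2 : ℝ)⁻¹ := by rw [hnorm]; norm_num; linarith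
    have happ := hk₀ k hk0 z hz_box hlow hup
    -- the kernel is ≥ 2⁻⁸ at this point
    have hker : ((2 : ℝ) ^ 8)⁻¹ ≤ ker (βs k) (Ls k) z := by
      show ((2 : ℝ) ^ 8)⁻¹ ≤ (‖α • siteToE z‖ ^ 8)⁻¹
      have hpos : 0 < ‖α • siteToE z‖ := by linarith
      exact inv_anti₀ (pow_pos hpos 8) (pow_le_pow_left₀ hpos.le (by rw [hnorm]; exact hαm2) 8)
    refine ⟨α • siteToE z, ?_, ?_⟩
    · have hpos : 0 < ‖α • siteToE z‖ := by linarith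
      exact norm_pos_iff.1 hpos
    · intro hK0
      rw [hK0, sub_zero] at happ
      have h1 : ker (βs k) (Ls k) z ≤ ((2 : ℝ) ^ 9)⁻¹ := le_trans (le_abs_self _) happ
      have h2 : ((2 : ℝ) ^ 8)⁻¹ ≤ ((2 : ℝ) ^ 9)⁻¹ := le_trans hker h1
      norm_num at h2

end Summit.QuantumFields.YangMills.Cruxes.NonContactScheme.Rung
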